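import Mathlib

/-!
# Exact Lipschitz conical self-similar Euler profiles; the Burgers–Leray vortex

Solo seat `solo-NavierStokesRegularity-informed`, session 11 (new mathematics *about the summit
statement*: the ¬S side — what an exactly self-similar blow-up profile can look like). Kernel companion
of `paper/cascades-and-cones.md` (Theorem 5, Proposition 6, Proposition 8 there).

Context. The self-similar Euler profile equation with rate `γ`,
`(PE)  (1-γ) U + γ (y·∇) U + (U·∇) U + ∇P = 0`, `div U = 0` on `ℝ³`,
has no `C¹` solutions with the radial far-field condition when `0 < γ < 1/2` except irrotational
ones (`SoloInformedStagnationCurve`, paper Theorem 4). The remaining loophole is a profile that is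
Lipschitz but not `C¹` at a stagnation point; its blow-up ("tangent cone") there is a 1-homogeneous
solution of the `γ`-free cone equation `C + (C·∇)C + ∇π = 0`. This file certifies the EXPLICIT
non-`C¹` solutions found in session 11:

* Family I: `C = (x, y, -2 z + n(x,y))` for ANY 1-homogeneous `n` — pointwise, the three components of
  `(PE)` and `div C = 0` follow from Euler's relation `x ∂ₓn + y ∂ᵧn = n` alone
  (`familyI_profile_identity`), for every `γ`;
* the concrete cone `C_w = (x, y, -2 z - w √(x²+y²))`: the partial derivatives of the third component
  along the three coordinate lines are PROVED (`HasDerivAt`, off the axis `x² + y² > 0`), and with them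
  the `(PE)` identities, incompressibility and `|curl C_w|² = w²` (`conicalProfile_Cw`); on the cone
  `3 z = -w ρ` the field is purely radial, `h · C = |h|²`, and the similarity velocity `γ h + C` equals
  `(1+γ) h` there — expansion at exactly the critical rate `1 + γ` (`cone_radial`); the backward
  similarity flow near such a vertex is explicitly integrable and every orbit off the invariant cone
  escapes (`familyI_backward_orbit`, `familyI_backward_escape`: the vertex cannot absorb — hence cannot
  feed vorticity to — a positive-measure set of backward orbits, paper Proposition 7);
* Family II (kink plane): `C = (σ x, y, -(1+σ) z + k x)` on each half-space (`familyII_profile_identity`);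
* the Burgers–Leray vortex: for Leray's equation (`γ = 1/2` with viscosity) the ansatz
  `U = A z + u_θ(r) e_θ`, `A = diag(a, a, -2a)`, reduces to the ODE
  `ω'' + ω'/r - (1/2 + a) r ω' - (1 + 2a) ω = 0` for the axial vorticity, solved by the Gaussian
  `ω = exp(-β r²)` exactly when `4β = -(1+2a)`; `β > 0 ↔ a < -1/2` (`burgersLeray_ode`,
  `burgersLeray_beta_pos_iff`); at `a = -1/2` the uniform-vorticity LINEAR field solves Leray's
  equation (`uniformVorticityLeray_symm`: `M + M²` is symmetric).

What is NOT checked here: that these componentwise identities are the PDE (bookkeeping of which slice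
derivative is which partial is displayed in the statements, not abstracted), the distributional form
across the axis / kink plane, and everything analytic in the paper (blow-up covariance, the sphere-flow
identities, the non-absorption proposition). Elementary calculus and algebra; Mathlib only.
-/

noncomputable section

open Real

namespace Summit.NavierStokesRegularity.NavierStokesRegularity.Theorems

/-! ## 1. Family I: the superposition identity, pointwise -/

/-- Family I, pointwise form. At a point `(x,y,z)` let `n, nx, ny` be the value and the horizontal
partials of a transverse component satisfying Euler's relation `x nx + y ny = n` (1-homogeneity).
Then `C = (x, y, -2z + n)` with `∇C_z = (nx, ny, -2)`, `V = γ h + C` and `P = -(x²+y²+z²)` satisfy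
the three components of `(1-γ) C + (V·∇) C + ∇P = 0` and `div C = 0`, for every `γ`. -/
theorem familyI_profile_identity (γ x y z n nx ny : ℝ) (heuler : x * nx + y * ny = n) :
    (1 - γ) * x + ((γ * x + x) * 1 + (γ * y + y) * 0 + (γ * z + (-2 * z + n)) * 0) + (-2 * x) = 0 ∧
    (1 - γ) * y + ((γ * x + x) * 0 + (γ * y + y) * 1 + (γ * z + (-2 * z + n)) * 0) + (-2 * y) = 0 ∧
    (1 - γ) * (-2 * z + n)
        + ((γ * x + x) * nx + (γ * y + y) * ny + (γ * z + (-2 * z + n)) * (-2)) + (-2 * z) = 0 ∧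
    (1 : ℝ) + 1 + (-2) = 0 := by
  refine ⟨by ring, by ring, ?_, by norm_num⟩
  linear_combination (1 + γ) * heuler

/-! ## 2. The concrete cone `C_w` -/

/-- `ρ² = x² + y²` for the horizontal radius `ρ = √(x² + y²)` (written out everywhere below) -/
theorem rho_sq (x y : ℝ) : √(x ^ 2 + y ^ 2) ^ 2 = x ^ 2 + y ^ 2 := Real.sq_sqrt (by positivity)

/-- `ρ > 0` off the axis -/
theorem rho_pos {x y : ℝ} (h : 0 < x ^ 2 + y ^ 2) : 0 < √(x ^ 2 + y ^ 2) := Real.sqrt_pos.2 h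

/-- `∂ρ/∂x = x/ρ` off the axis (derivative along the first coordinate line). -/
theorem hasDerivAt_rho_fst {x y : ℝ} (h : 0 < x ^ 2 + y ^ 2) :
    HasDerivAt (fun t => √(t ^ 2 + y ^ 2)) (x / √(x ^ 2 + y ^ 2)) x := by
  have hf : HasDerivAt (fun t : ℝ => t ^ 2 + y ^ 2) (2 * x) x := by
    simpa using (hasDerivAt_pow 2 x).add_const (y ^ 2)
  have hs := hf.sqrt (ne_of_gt h)
  have hval : 2 * x / (2 * √(x ^ 2 + y ^ 2)) = x / √(x ^ 2 + y ^ 2) := by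
    exact mul_div_mul_left x _ two_ne_zero
  exact hs.congr_deriv hval

/-- `∂ρ/∂y = y/ρ` off the axis. -/
theorem hasDerivAt_rho_snd {x y : ℝ} (h : 0 < x ^ 2 + y ^ 2) :
    HasDerivAt (fun t => √(x ^ 2 + t ^ 2)) (y / √(x ^ 2 + y ^ 2)) y := by
  have hf : HasDerivAt (fun t : ℝ => x ^ 2 + t ^ 2) (2 * y) y := by
    simpa using (hasDerivAt_pow 2 y).const_add (x ^ 2)
  have hs := hf.sqrt (ne_of_gt h)
  have hval : 2 * y / (2 * √(x ^ 2 + y ^ 2)) = y / √(x ^ 2 + y ^ 2) := by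
    exact mul_div_mul_left y _ two_ne_zero
  exact hs.congr_deriv hval

/-- `∂C_z/∂x = -w x/ρ` off the axis -/
theorem hasDerivAt_Cz_fst (w : ℝ) {x y : ℝ} (z : ℝ) (h : 0 < x ^ 2 + y ^ 2) :
    HasDerivAt (fun t => (-2 * z - w * √(t ^ 2 + y ^ 2))) (-(w * (x / √(x ^ 2 + y ^ 2)))) x := by
  have := ((hasDerivAt_rho_fst h).const_mul w).const_sub (-2 * z)
  simpa using this

/-- `∂C_z/∂y = -w y/ρ` off the axis -/
theorem hasDerivAt_Cz_snd (w : ℝ) {x y : ℝ} (z : ℝ) (h : 0 < x ^ 2 + y ^ 2) :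
    HasDerivAt (fun t => (-2 * z - w * √(x ^ 2 + t ^ 2))) (-(w * (y / √(x ^ 2 + y ^ 2)))) y := by
  have := ((hasDerivAt_rho_snd h).const_mul w).const_sub (-2 * z)
  simpa using this

/-- `∂C_z/∂z = -2` -/
theorem hasDerivAt_Cz_thd (w x y z : ℝ) :
    HasDerivAt (fun t => (-2 * t - w * √(x ^ 2 + y ^ 2))) (-2) z := by
  have := ((hasDerivAt_id z).const_mul (-2 : ℝ)).sub_const (w * √(x ^ 2 + y ^ 2))
  simpa using this

/-- THEOREM 5 of the paper for `n = -w ρ`: off the axis, `C_w = (x, y, -2 z - w ρ)` with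
`P = -(x²+y²+z²)` solves the profile equation `(1-γ) C + ((γ h + C)·∇) C + ∇P = 0` for EVERY `γ`,
is divergence free, and has `|curl C_w|² = w²`. The partial derivatives of `C_z` used in the identity
are the proved line derivatives (first three conjuncts); those of `C_x = x`, `C_y = y`, `P` are the
displayed constants/linear terms. -/
theorem conicalProfile_Cw (γ w x y z : ℝ) (h : 0 < x ^ 2 + y ^ 2) :
    HasDerivAt (fun t => (-2 * z - w * √(t ^ 2 + y ^ 2))) (-(w * (x / √(x ^ 2 + y ^ 2)))) x ∧
    HasDerivAt (fun t => (-2 * z - w * √(x ^ 2 + t ^ 2))) (-(w * (y / √(x ^ 2 + y ^ 2)))) y ∧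
    HasDerivAt (fun t => (-2 * t - w * √(x ^ 2 + y ^ 2))) (-2) z ∧
    (1 - γ) * x + ((γ * x + x) * 1) + (-2 * x) = 0 ∧
    (1 - γ) * y + ((γ * y + y) * 1) + (-2 * y) = 0 ∧
    (1 - γ) * (-2 * z - w * √(x ^ 2 + y ^ 2))
      + ((γ * x + x) * (-(w * (x / √(x ^ 2 + y ^ 2)))) + (γ * y + y) * (-(w * (y / √(x ^ 2 + y ^ 2))))
          + (γ * z + (-2 * z - w * √(x ^ 2 + y ^ 2))) * (-2))
      + (-2 * z) = 0 ∧
    (1 : ℝ) + 1 + (-2) = 0 ∧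
    (-(w * (y / √(x ^ 2 + y ^ 2))) - 0) ^ 2 + (0 - (-(w * (x / √(x ^ 2 + y ^ 2))))) ^ 2 + ((0 : ℝ) - 0) ^ 2
      = w ^ 2 := by
  refine ⟨hasDerivAt_Cz_fst w z h, hasDerivAt_Cz_snd w z h, hasDerivAt_Cz_thd w x y z,
    by ring, by ring, ?_, by norm_num, ?_⟩
  · have hs2 : √(x ^ 2 + y ^ 2) ^ 2 = x ^ 2 + y ^ 2 := rho_sq x y
    set ρ := √(x ^ 2 + y ^ 2) with hρdef
    have hρ : ρ ≠ 0 := (rho_pos h).ne'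
    have heuler : x * (-(w * (x / ρ))) + y * (-(w * (y / ρ))) = -(w * ρ) := by
      have e1 : x * (-(w * (x / ρ))) + y * (-(w * (y / ρ))) = -(w * ((x ^ 2 + y ^ 2) / ρ)) := by
        ring
      rw [e1, ← hs2, pow_two, mul_self_div_self]
    linear_combination (1 + γ) * heuler
  · have hs2 : √(x ^ 2 + y ^ 2) ^ 2 = x ^ 2 + y ^ 2 := rho_sq x y
    set ρ := √(x ^ 2 + y ^ 2) with hρdef
    have hρ : ρ ≠ 0 := (rho_pos h).ne'
    have e2 : (-(w * (y / ρ)) - 0) ^ 2 + (0 - (-(w * (x / ρ)))) ^ 2 + ((0 : ℝ) - 0) ^ 2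
        = w ^ 2 * ((x ^ 2 + y ^ 2) / ρ ^ 2) := by ring
    rw [e2, ← hs2, div_self (pow_ne_zero 2 hρ), mul_one]

/-- On the cone `3 z = -w ρ` (spherical angle `tan φ_b = -3/w`): `h · C_w = |h|²` (normal component
`c_n = 1`) and the similarity velocity `γ h + C_w` is exactly `(1+γ) h` — the cone is invariant and
expands at the critical rate `1 + γ` of the paper's Theorem 3. -/
theorem cone_radial (w x y z : ℝ) (hcone : 3 * z = -(w * √(x ^ 2 + y ^ 2))) :
    x * x + y * y + z * (-2 * z - w * √(x ^ 2 + y ^ 2)) = x ^ 2 + y ^ 2 + z ^ 2 ∧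
    ∀ γ : ℝ, γ * x + x = (1 + γ) * x ∧ γ * y + y = (1 + γ) * y ∧
      γ * z + (-2 * z - w * √(x ^ 2 + y ^ 2)) = (1 + γ) * z := by
  refine ⟨by linear_combination (-z) * hcone, fun γ => ⟨by ring, by ring, ?_⟩⟩
  linear_combination (-1 : ℝ) * hcone

/-! ### Non-absorption (paper Proposition 7): the backward similarity flow near a Family-I vertex

For `V = γ h + C`, `C = (x, y, -2z + n(x,y))`, the backward flow `ḣ = -V(h)` reads
`ẋ = -(1+γ) x`, `ẏ = -(1+γ) y`, `ż = (2-γ) z - n(x,y)`; since `n` is 1-homogeneous,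
`n(x(t),y(t)) = e^{-(1+γ)t} n₀` along the (explicit) horizontal solution, and the `z`-equation is
solved in closed form. Off the invariant cone `3 z₀ = n₀` every orbit escapes to infinity. -/

/-- the explicit backward orbit: horizontal component and the `z`-component solve the ODEs. -/
theorem familyI_backward_orbit (γ x₀ z₀ n₀ t : ℝ) :
    HasDerivAt (fun s => Real.exp (-(1 + γ) * s) * x₀)
      (-(1 + γ) * (Real.exp (-(1 + γ) * t) * x₀)) t ∧
    HasDerivAt (fun s => Real.exp ((2 - γ) * s) * (z₀ - n₀ / 3) + n₀ / 3 * Real.exp (-(1 + γ) * s))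
      ((2 - γ) * (Real.exp ((2 - γ) * t) * (z₀ - n₀ / 3) + n₀ / 3 * Real.exp (-(1 + γ) * t))
        - Real.exp (-(1 + γ) * t) * n₀) t := by
  have hlin : ∀ c : ℝ, HasDerivAt (fun s : ℝ => c * s) c t := fun c => by
    simpa using (hasDerivAt_id t).const_mul c
  have he : ∀ c : ℝ, HasDerivAt (fun s : ℝ => Real.exp (c * s)) (Real.exp (c * t) * c) t :=
    fun c => (hlin c).exp
  constructor
  · exact ((he (-(1 + γ))).mul_const x₀).congr_deriv (by ring)
  · exact (((he (2 - γ)).mul_const (z₀ - n₀ / 3)).add ((he (-(1 + γ))).const_mul (n₀ / 3))).congr_deriv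
      (by ring)

open Filter Topology in
/-- escape: if `3 z₀ ≠ n₀` (off the invariant cone) the `z`-component is unbounded as `t → ∞`
(`0 < γ < 1/2` is more than enough; we use `-1 ≤ γ < 2`). -/
theorem familyI_backward_escape (γ z₀ n₀ : ℝ) (hγ : γ < 2) (hγ' : -1 ≤ γ) (hc : z₀ ≠ n₀ / 3) :
    Tendsto (fun t => |Real.exp ((2 - γ) * t) * (z₀ - n₀ / 3) + n₀ / 3 * Real.exp (-(1 + γ) * t)|)
      atTop atTop := by
  have hcpos : 0 < |z₀ - n₀ / 3| := abs_pos.2 (sub_ne_zero.2 hc)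
  have hlin : Tendsto (fun t : ℝ => (2 - γ) * t) atTop atTop :=
    tendsto_id.const_mul_atTop (by linarith : 0 < 2 - γ)
  have hexp : Tendsto (fun t => Real.exp ((2 - γ) * t)) atTop atTop :=
    Real.tendsto_exp_atTop.comp hlin
  have h1 : Tendsto (fun t => |z₀ - n₀ / 3| * Real.exp ((2 - γ) * t) + -|n₀ / 3|) atTop atTop :=
    tendsto_atTop_add_const_right _ _ (hexp.const_mul_atTop hcpos)
  refine tendsto_atTop_mono' atTop ?_ h1
  filter_upwards [eventually_ge_atTop 0] with t ht
  set A := Real.exp ((2 - γ) * t) * (z₀ - n₀ / 3) with hA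
  set B := n₀ / 3 * Real.exp (-(1 + γ) * t) with hB
  have hexp_le : Real.exp (-(1 + γ) * t) ≤ 1 := by
    rw [Real.exp_le_one_iff]
    nlinarith
  have hBle : |B| ≤ |n₀ / 3| := by
    rw [hB, abs_mul, abs_of_pos (Real.exp_pos _)]
    exact mul_le_of_le_one_right (abs_nonneg _) hexp_le
  have hAeq : |A| = |z₀ - n₀ / 3| * Real.exp ((2 - γ) * t) := by
    rw [hA, abs_mul, abs_of_pos (Real.exp_pos _), mul_comm]
  have key : |A| ≤ |A + B| + |B| := by
    calc |A| = |(A + B) - B| := by ring_nf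
      _ ≤ |A + B| + |B| := abs_sub _ _
  linarith

/-! ## 3. Family II: the kink plane -/

/-- Family II pointwise: `C = (σ x, y, -(1+σ) z + k x)`, `∇C_z = (k, 0, -(1+σ))`,
`P = -σ(1+σ)(x²+z²)/2 - y²`, `V = γ h + C`: the three components of `(PE)` and `div C = 0` hold for
every `γ, σ, k` (so with `k = k₊` on `{x > 0}` and `k = -k₋` on `{x < 0}` one gets the Lipschitz,
non-`C¹` "kink plane" profiles; `k` constant gives the resonant linear vortical profiles). -/
theorem familyII_profile_identity (γ σ k x y z : ℝ) :
    (1 - γ) * (σ * x) + ((γ * x + σ * x) * σ) + (-(σ * (1 + σ) * x)) = 0 ∧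
    (1 - γ) * y + ((γ * y + y) * 1) + (-2 * y) = 0 ∧
    (1 - γ) * (-(1 + σ) * z + k * x)
      + ((γ * x + σ * x) * k + (γ * y + y) * 0 + (γ * z + (-(1 + σ) * z + k * x)) * (-(1 + σ)))
      + (-(σ * (1 + σ) * z)) = 0 ∧
    σ + 1 + (-(1 + σ)) = 0 := by
  refine ⟨by ring, by ring, by ring, by ring⟩

/-! ## 4. The Burgers–Leray vortex -/

/-! Written out below: `ω(r) = exp(-β r²)`, `ω'(r) = (-(2β) r) ω(r)`, `ω''(r) = (-2β + 4β²r²) ω(r)`. -/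

/-- `ω'(r) = -2βr ω(r)` for `ω = exp(-β r²)` -/
theorem hasDerivAt_omegaBL (β r : ℝ) : HasDerivAt (fun s => Real.exp (-β * s ^ 2)) (((-(2 * β) * r) * Real.exp (-β * r ^ 2))) r := by
  have h1 : HasDerivAt (fun s : ℝ => -β * s ^ 2) (-β * (2 * r)) r := by
    simpa using (hasDerivAt_pow 2 r).const_mul (-β)
  have h2 : HasDerivAt (fun s : ℝ => Real.exp (-β * s ^ 2))
      (Real.exp (-β * r ^ 2) * (-β * (2 * r))) r := h1.exp
  have hval : Real.exp (-β * r ^ 2) * (-β * (2 * r)) = ((-(2 * β) * r) * Real.exp (-β * r ^ 2)) := by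
    ring
  exact h2.congr_deriv hval

/-- `ω'' = (-2β + 4β²r²) ω` -/
theorem hasDerivAt_domegaBL (β r : ℝ) :
    HasDerivAt (fun s => (-(2 * β) * s) * Real.exp (-β * s ^ 2)) ((-(2 * β) + 4 * β ^ 2 * r ^ 2) * Real.exp (-β * r ^ 2)) r := by
  have h1 : HasDerivAt (fun s : ℝ => -(2 * β) * s) (-(2 * β)) r := by
    simpa using (hasDerivAt_id r).const_mul (-(2 * β))
  have h2 : HasDerivAt (fun s : ℝ => (-(2 * β) * s) * Real.exp (-β * s ^ 2))
      (-(2 * β) * Real.exp (-β * r ^ 2) + (-(2 * β) * r) * ((-(2 * β) * r) * Real.exp (-β * r ^ 2))) r :=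
    h1.mul (hasDerivAt_omegaBL β r)
  have hval : -(2 * β) * Real.exp (-β * r ^ 2) + (-(2 * β) * r) * ((-(2 * β) * r) * Real.exp (-β * r ^ 2))
      = (-(2 * β) + 4 * β ^ 2 * r ^ 2) * Real.exp (-β * r ^ 2) := by
    ring
  exact h2.congr_deriv hval

/-- PROPOSITION 8 of the paper (the ODE step). For Leray's profile equation
`½U + ½(z·∇)U + (U·∇)U + ∇P = ΔU` the ansatz `U = Az + u_θ(r)e_θ`, `A = diag(a,a,-2a)`, reduces (by
taking the curl) to `ω'' + ω'/r - (1/2 + a) r ω' - (1 + 2a) ω = 0` for the axial vorticity. With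
`4β = -(1+2a)` the Gaussian `ω = exp(-β r²)` solves it: here `ω'` and `ω''` are the certified first and second derivatives of `exp(-β r²)` (first two
conjuncts). -/
theorem burgersLeray_ode (a β r : ℝ) (hβ : 4 * β = -(1 + 2 * a)) (hr : r ≠ 0) :
    HasDerivAt (fun s => Real.exp (-β * s ^ 2)) (((-(2 * β) * r) * Real.exp (-β * r ^ 2))) r ∧
    HasDerivAt (fun s => (-(2 * β) * s) * Real.exp (-β * s ^ 2)) ((-(2 * β) + 4 * β ^ 2 * r ^ 2) * Real.exp (-β * r ^ 2)) r ∧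
    (-(2 * β) + 4 * β ^ 2 * r ^ 2) * Real.exp (-β * r ^ 2) + ((-(2 * β) * r) * Real.exp (-β * r ^ 2)) / r
      - (1 / 2 + a) * r * ((-(2 * β) * r) * Real.exp (-β * r ^ 2)) - (1 + 2 * a) * Real.exp (-β * r ^ 2) = 0 := by
  refine ⟨hasDerivAt_omegaBL β r, hasDerivAt_domegaBL β r, ?_⟩
  have hq : ((-(2 * β) * r) * Real.exp (-β * r ^ 2)) / r = -(2 * β) * Real.exp (-β * r ^ 2) := by
    field_simp
    try ring
  rw [hq]
  linear_combination (r ^ 2 * β - 1) * Real.exp (-β * r ^ 2) * hβ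

/-- the Gaussian is localised (`β > 0`) iff the horizontal strain beats the self-similar drift. -/
theorem burgersLeray_beta_pos_iff (a β : ℝ) (hβ : 4 * β = -(1 + 2 * a)) : 0 < β ↔ a < -1 / 2 := by
  constructor <;> intro h <;> linarith

/-- At the threshold `a = -1/2` (`β = 0`, uniform vorticity): the LINEAR field `U = M z`,
`M = diag(-1/2,-1/2,1) + k (e₂ ⊗ e₁ - e₁ ⊗ e₂)`, solves Leray's equation, because for linear fields
the equation reads `(M + M²) z = -∇P` (Laplacian zero, `2 a_L = 1`) and `M + M²` is symmetric. -/
theorem uniformVorticityLeray_symm (k : ℝ) :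
    let M : Matrix (Fin 3) (Fin 3) ℝ := !![-1/2, -k, 0; k, -1/2, 0; 0, 0, 1]
    (M + M * M).IsSymm ∧ Matrix.trace M = 0 := by
  intro M
  constructor
  · apply Matrix.IsSymm.ext
    intro i j
    fin_cases i <;> fin_cases j <;>
      simp [M, Matrix.add_apply] <;> try ring
  · simp [M, Matrix.trace, Fin.sum_univ_three]
    try ring

end Summit.NavierStokesRegularity.NavierStokesRegularity.Theorems
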